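import Summits.KontsevichZagierPeriods.KontsevichZagierPeriods.Theorems.RootDecompZetaThreeFrontierWordRungTwoP3

/-! # `RootDecompZetaThreeFrontierWordRungTwoP4` — part 4/12 of the mechanical ≤270-line split of `RungTwo.stripped.lean`
(split by the decomp-kz census seat for landing; mathematics unchanged; part 4 continues part 3). -/

/-! # `RootDecompZetaThreeFrontierWordRungTwoP4a` — part 1/2 of the mechanical ≤175-line split of `P4src.lean`
(split by the decomp-kz census seat for landing; mathematics unchanged). -/

noncomputable section

namespace Summit.KontsevichZagierPeriods.RootDecompZetaThreeFrontier.WordLayer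
open Set MeasureTheory MvPolynomial
open Literature.NumberTheory.Transcendental
open Summit.KontsevichZagierPeriods.KontsevichZagierPeriods.Theses.RootDecompZetaThreeFrontier
  (HigherWeightDescent)
open Summit.KontsevichZagierPeriods.KontsevichZagierPeriods.Theses.LinRedNormalForm
  (DihedralNormalForm MzvKernelInKZ HoffmanSpanInKZ HoffmanIndependence)

section RungTwoSpecimen
open Literature.ModelTheory.ExponentialFields (IsSemialgebraic)

/-! (private copy of `strictAnti_fin_one` — dedup.landed / split policy; origin part RootDecompZetaThreeFrontierWordRungTwoP1) -/
/-- Auxiliary step `strictAnti_fin_one`. [bookkeeping] -/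
private theorem strictAnti_fin_one (y : Fin 1 → ℝ) : StrictAnti y := fun a b hab =>
  absurd hab (by rw [Subsingleton.elim a b]; exact lt_irrefl _)

/-! (private copy of `mem_simplex_one_iff` — dedup.landed / split policy; origin part RootDecompZetaThreeFrontierWordRungTwoP1) -/
/-- Membership in `simplex_one_iff`, unfolded. [bookkeeping] -/
private theorem mem_simplex_one_iff (y : Fin 1 → ℝ) : y ∈ KZ.openOrderedSimplex 1 ↔ 0 < y 0 ∧ y 0 < 1 := by
  constructor
  · rintro ⟨h0, h1, -⟩
    exact ⟨h0 0, h1 0⟩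
  · rintro ⟨h0, h1⟩
    refine ⟨fun i => ?_, fun i => ?_, strictAnti_fin_one y⟩
    · rw [Fin.fin_one_eq_zero i]; exact h0
    · rw [Fin.fin_one_eq_zero i]; exact h1

/-! (private copy of `mem_simplex_two_iff` — dedup.landed / split policy; origin part RootDecompZetaThreeFrontierWordRungTwoP1) -/
/-- Membership in `simplex_two_iff`, unfolded. [bookkeeping] -/
private theorem mem_simplex_two_iff (z : Fin 2 → ℝ) :
    z ∈ KZ.openOrderedSimplex 2 ↔ 0 < z 1 ∧ z 1 < z 0 ∧ z 0 < 1 := by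
  constructor
  · rintro ⟨h0, h1, ha⟩
    exact ⟨h0 1, ha (show (0 : Fin 2) < 1 by decide), h1 0⟩
  · rintro ⟨h1, h10, h0⟩
    refine ⟨Fin.forall_fin_two.mpr ⟨h1.trans h10, h1⟩, Fin.forall_fin_two.mpr ⟨h0, h10.trans h0⟩,
      Fin.strictAnti_iff_succ_lt.mpr (Fin.forall_fin_one.mpr ?_)⟩
    simpa using h10

/-- Auxiliary step `spW`. [bookkeeping] -/
def spW (z : Fin 2 → ℝ) : ℝ := 1 / (z 0 * (1 - z 1))

/-- the duality involution of `Δ₂` and its (constant) derivative -/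
def spΦ (z : Fin 2 → ℝ) : Fin 2 → ℝ := ![1 - z 1, 1 - z 0]

/-- Auxiliary step `spL`. [bookkeeping] -/
def spL : (Fin 2 → ℝ) →L[ℝ] (Fin 2 → ℝ) :=
  -(ContinuousLinearMap.pi fun i : Fin 2 =>
    ContinuousLinearMap.proj (R := ℝ) (φ := fun _ : Fin 2 => ℝ) (Equiv.swap (0 : Fin 2) 1 i))

/-- Auxiliary step `spL_apply`. [bookkeeping] -/
theorem spL_apply (w : Fin 2 → ℝ) (i : Fin 2) : spL w i = -w (Equiv.swap (0 : Fin 2) 1 i) := by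
  simp [spL]

/-- Auxiliary step `spΦ_zero`. [bookkeeping] -/
theorem spΦ_zero (z : Fin 2 → ℝ) : spΦ z 0 = 1 - z 1 := by simp [spΦ]

/-- Auxiliary step `spΦ_one`. [bookkeeping] -/
theorem spΦ_one (z : Fin 2 → ℝ) : spΦ z 1 = 1 - z 0 := by simp [spΦ]

/-- Auxiliary step `spΦ_spΦ`. [bookkeeping] -/
theorem spΦ_spΦ (z : Fin 2 → ℝ) : spΦ (spΦ z) = z := by
  funext i
  fin_cases i <;> simp [spΦ_zero, spΦ_one]

/-- Auxiliary step `spΦ_eq`. [bookkeeping] -/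
theorem spΦ_eq (z : Fin 2 → ℝ) : spΦ z = (fun _ => (1 : ℝ)) + spL z := by
  funext i
  fin_cases i
  · simp [spΦ_zero, spL_apply, Equiv.swap_apply_left, sub_eq_add_neg]
  · simp [spΦ_one, spL_apply, Equiv.swap_apply_right, sub_eq_add_neg]

/-- Auxiliary step `spL_spL`. [bookkeeping] -/
theorem spL_spL (w : Fin 2 → ℝ) : spL (spL w) = w := by
  funext i
  fin_cases i <;> simp [spL_apply, Equiv.swap_apply_left, Equiv.swap_apply_right]

/-- `|det|` of the involution is `1` -/
theorem abs_det_spL : |spL.det| = 1 := by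
  have hcomp : (spL : (Fin 2 → ℝ) →ₗ[ℝ] (Fin 2 → ℝ)) ∘ₗ (spL : (Fin 2 → ℝ) →ₗ[ℝ] (Fin 2 → ℝ)) =
      LinearMap.id := by
    apply LinearMap.ext
    intro w
    simp [spL_spL]
  have h := congrArg LinearMap.det hcomp
  rw [LinearMap.det_comp, LinearMap.det_id] at h
  have h2 : |LinearMap.det (spL : (Fin 2 → ℝ) →ₗ[ℝ] (Fin 2 → ℝ))| ^ 2 = 1 := by
    rw [sq_abs, sq, h]
  exact (pow_eq_one_iff_of_nonneg (abs_nonneg _) two_ne_zero).1 h2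

/-- Membership in `simplex_two_spΦ`, unfolded. [bookkeeping] -/
theorem mem_simplex_two_spΦ {z : Fin 2 → ℝ} (hz : z ∈ KZ.openOrderedSimplex 2) :
    spΦ z ∈ KZ.openOrderedSimplex 2 := by
  rw [mem_simplex_two_iff] at hz ⊢
  rw [spΦ_zero, spΦ_one]
  obtain ⟨h1, h10, h0⟩ := hz
  exact ⟨by linarith, by linarith, by linarith⟩

/-- Auxiliary step `image_spΦ`. [bookkeeping] -/
theorem image_spΦ : spΦ '' KZ.openOrderedSimplex 2 = KZ.openOrderedSimplex 2 := by
  ext u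
  constructor
  · rintro ⟨z, hz, rfl⟩
    exact mem_simplex_two_spΦ hz
  · intro hu
    exact ⟨spΦ u, mem_simplex_two_spΦ hu, spΦ_spΦ u⟩

/-- domination by an integrable function on a `ℚ`-semialgebraic set -/
theorem integrableOn_of_dominated {n : ℕ} {S : Set (Fin n → ℝ)} (hS : IsSemialgebraic ℚ S)
    {f g : (Fin n → ℝ) → ℝ} (hf : IsSemialgebraicFunOn ℚ S f) (hg : IntegrableOn g S)
    (h : ∀ z ∈ S, |f z| ≤ g z) : IntegrableOn f S := by
  have hSm : MeasurableSet S := IsSemialgebraic.measurableSet_holds hS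
  refine Integrable.mono' hg (KZ.aestronglyMeasurable_of_isSemialgebraicFunOn hf hSm) ?_
  rw [ae_restrict_iff' hSm]
  exact Filter.Eventually.of_forall fun z hz => by rw [Real.norm_eq_abs]; exact h z hz

/-- a representation on `Δ₂` -/
def repTwo (f : (Fin 2 → ℝ) → ℝ) (hf : IsSemialgebraicFunOn ℚ (KZ.openOrderedSimplex 2) f)
    (hi : IntegrableOn f (KZ.openOrderedSimplex 2)) : KZ.IntegralRep 2 :=
  ⟨KZ.openOrderedSimplex 2, f, KZ.isSemialgebraic_openOrderedSimplex 2, hf, hi⟩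

/-- `simplex` is measurable. [bookkeeping] -/
private theorem measurableSet_simplex (k : ℕ) : MeasurableSet (KZ.openOrderedSimplex k) :=
  IsSemialgebraic.measurableSet_holds (KZ.isSemialgebraic_openOrderedSimplex k)

/-! #### the closed band `B = {(t₀,t₁) | t₀ ∈ (0,1), 0 ≤ t₁ ≤ t₀}` over `Δ₁` -/

/-- Membership in `bandTwo_iff`, unfolded. [bookkeeping] -/
theorem mem_bandTwo_iff (z : Fin 2 → ℝ) :
    z ∈ KZlog.band (KZ.openOrderedSimplex 1) (fun _ => (0 : ℝ)) (fun y => y (Fin.last 0)) ↔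
      (0 < z 0 ∧ z 0 < 1) ∧ 0 ≤ z 1 ∧ z 1 ≤ z 0 := by
  rw [KZlog.mem_band, mem_simplex_one_iff]
  exact Iff.rfl

/-- `bandTwo` is `ℚ`-semialgebraic. [BCR1998 §2.2] -/
theorem isSemialgebraic_bandTwo :
    IsSemialgebraic ℚ (KZlog.band (KZ.openOrderedSimplex 1) (fun _ => (0 : ℝ)) (fun y => y (Fin.last 0))) := by
  have hτ₁ := KZ.isSemialgebraic_openOrderedSimplex 1
  exact KZlog.isSemialgebraic_band
    ((isSemialgebraicFunOn_aeval hτ₁ (0 : MvPolynomial (Fin 1) ℚ)).congr fun y _ => by simp)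
    ((isSemialgebraicFunOn_aeval hτ₁ (MvPolynomial.X (Fin.last 0))).congr fun y _ => by simp)

/-! #### semialgebraicity of the six rational functions -/

/-! #### integrability: everything is dominated by the word `ω₀ω₁ = 1/(t₀(1-t₁))` -/

/-- Auxiliary step `spW_integrableOn`. [bookkeeping] -/
theorem spW_integrableOn : IntegrableOn spW (KZ.openOrderedSimplex 2) := by
  have h := (k2 1).integrableOn
  have hd : (k2 1).domain = KZ.openOrderedSimplex 2 := k2_domain 1
  rw [hd] at h
  exact h.congr_fun (fun z _ => by rw [k2_integrand]; simp [spW]) (measurableSet_simplex 2)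

/-! #### the moves -/

end RungTwoSpecimen
/-! ## §13  Route-vocabulary one-liners of the two move facts (for the writer's `--signature`s)

`DivergenceLEThree` is already stated over `KZ.*` only.  `DualityThree'` replaces the canonical
representative `k3 q` by a universally quantified `z` described by its domain and integrand (the style of
item 28709); `dualityThree'_iff` is the by-name equivalence, and `genusZeroThreeNormalForm_of_moves'` is
item 28709 from the three route-vocabulary statements `GZNormalFormWThree' ∧ DivergenceLEThree ∧ DualityThree'`
(the exact texts certified to elaborate in the ROUTE FILE's import/namespace context: `g9/bc/RouteVocab.lean`). -/

end Summit.KontsevichZagierPeriods.RootDecompZetaThreeFrontier.WordLayer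
end
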